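import Literature.NumberTheory.Automorphic.ReciprocityGLnRankOneProofs
import Literature.NumberTheory.Automorphic.ReciprocityGLnUniquenessHolds
import HarnessLib

/-!
# `GaloisRepOfRegularAlgebraic` (item stmt-Langlands-10785 of route IrreducibilityBySelfDuality;
# shared by CMFern and SteinbergVelocityDst): what the tree proves of it today

The route decl `Summit.Langlands.Langlands.Theses.IrreducibilityBySelfDuality.GaloisRepOfRegularAlgebraic`
is, verbatim with explicit binders, the named fact
`Literature.NumberTheory.Automorphic.exists_galoisRep_of_regularAlgebraic` (**lang.S27**:
Harris–Lan–Taylor–Thorne 2016 Thm. A + Scholze 2015 Cor. V.4.2, compatibility at *every*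
unramified `v ∤ ℓ` by Varma 2024 Thm. 1 / Cor. 9.3): for `K` totally real or CM and `π` a regular
algebraic cuspidal automorphic representation of `GL_n(𝔸_K)`, every `ℓ` and `ι : ℚ̄_ℓ ≃ ℂ`, a
continuous semisimple `r : Γ_K → GL_n(ℚ̄_ℓ)`, unramified with arithmetic-Frobenius characteristic
polynomial `arithFrobPolyOfSatake ι q_v n α` at every `v ∤ ℓ` where `π` has Satake parameter `α`.

This file does NOT import the Theses file (so that it can never close an import cycle when the
gate links a `_holds` into the route file); every theorem is stated on the item's text.  It records,
sorry-free and on the standard axioms: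

* `iff_fact` — the item's text ↔ `exists_galoisRep_of_regularAlgebraic` (`Iff.rfl`), and
  `of_fact` — the one-line closure the day `exists_galoisRep_of_regularAlgebraic_holds` lands;
* `of_leaves` — the item from the **finest leaves the tree has isolated**: HLTT Cor. 6.27
  (`HarrisLanTaylorThorne2016.corollary627_splitOrUnramified`), the archimedean clause of
  Arthur–Clozel's strong lifting (`ArthurClozel1989_strongLifting_archimedean`), Arthur–Clozel's
  strong cuspidal base change in prime degree (raw hypothesis `hBC`, no named fact in the tree:
  `BaseChangeUnramifiedLift` module docstring) — these three give Thm. A (existence) by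
  `HarrisLanTaylorThorne2016.theoremA_existence_of_leaves'` (patching, Chebotarev, Weil's rank-one
  case all proved in the tree) — and Varma's Cor. 9.3 (`Varma2024.corollary93_unramified`), by
  `exists_galoisRep_of_regularAlgebraic_of`;
* `rank_zero`, `rank_one`, `of_rank_le_one` — the slices `n = 0` and `n = 1` of the item, proved
  **unconditionally and for every number field** (no totally-real/CM hypothesis): `n = 1` is Weil's
  theorem on the `ℓ`-adic characters of algebraic Hecke characters (A. Weil 1956), in the tree as
  `HeckeCharacter.IsAlgebraic.exists_lAdic`, transported to the Borel–Jacquet datum model by the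
  `GL₁` dictionary of `ReciprocityGLnRankOneProofs` (`exists_heckeCharacter_glOne`,
  `isAlgebraic_heckeCharacter_glOne_of_isCAlgebraic`, `isUnramifiedAt_heckeCharacter_glOne`,
  `exists_eq_singleton_of_hasSatakeParamAt_glOne`).  The tree's `theoremA_existence_rank_one` has the
  weaker HLTT shape (`IsCompatible`: places over a rational prime above which `π` is unramified);
  here the conclusion is the item's (every `v ∤ ℓ` where `π` is unramified), which for `n = 1` costs
  nothing because a Hecke character is unramified wherever its automorphic datum is;
* `ae_of_theoremA_existence` — from HLTT's Thm. A (existence) ALONE, i.e. without Varma, the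
  **almost-everywhere** form of the item: `r` semisimple and compatible with `π` at all but finitely
  many places (the places over `ℓ` and over the rational primes below a ramified place of `π` are
  finitely many: Flath, `hasSatakeParamAt_cofinite_holds`).  Recorded for the planner: the route's
  cruxes (`EssSelfDualIrreducibleCM`, `ReducibleForcesEssSelfDual`, `IrreducibleGL3CM`) put only
  `∀ᶠ v in cofinite` compatibility hypotheses on the Galois representations they quantify over, so
  an item weakened to this almost-everywhere shape would leave Varma's theorem outside the route's
  cone.

References: M. Harris, K.-W. Lan, R. Taylor, J. Thorne, Res. Math. Sci. 3:37 (2016), Thm. A (p. 3),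
Cor. 6.27, Thm. 7.13, Cor. 7.14 (p. 232) [HarrisLanTaylorThorneRMS2016]; I. Varma, Forum Math.
Sigma 12 (2024) e21, Thm. 1, Cor. 9.3 [VarmaFMS2024]; A. Weil, *On a certain type of characters of
the idèle-class group of an algebraic number-field* (1956) [Weil1956]; J. Arthur, L. Clozel, Ann. of
Math. Stud. 120 (1989), Ch. 3 Thm. 4.2 (a), Thm. 5.1 [ArthurClozelAMS120]; D. Flath, Corvallis
(1979), Thm. 3.
-/

noncomputable section

set_option linter.dupNamespace false -- project-wide option (lakefile weak.linter.dupNamespace); `Summit.Langlands.Langlands` is the mandated namespace (D-0017)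

open scoped MatrixGroups Matrix Classical Polynomial NumberField
open NumberField IsDedekindDomain Field Polynomial Filter
open Literature.NumberTheory.Automorphic Literature.NumberTheory.GaloisRepresentations
open Literature.NumberTheory.Automorphic.HarrisLanTaylorThorne2016

namespace Summit.Langlands.Langlands.Theorems.GaloisRepOfRegularAlgebraic

/-! ### The item is the named fact lang.S27 -/

/-- **The item's text is the named fact `exists_galoisRep_of_regularAlgebraic`** (lang.S27), up to
the binder annotations of `n` and `K` (explicit in the route file, implicit in the fact), which are
definitionally irrelevant. [folklore] -/
theorem iff_fact :
    (∀ (n : ℕ) (K : Type) [Field K] [NumberField K] (hcpt : isCompact_glFiniteIntegralLevel n K),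
      (IsTotallyReal K ∨ IsCMField K) → ∀ (π : CuspidalAutomorphicRepData n K hcpt),
      π.1.IsRegularAlgebraic → ∀ (ℓ : ℕ) [Fact ℓ.Prime] (ι : PadicAlgCl ℓ ≃+* ℂ),
      ∃ r : FramedGaloisRep K (PadicAlgCl ℓ) n, r.toGaloisRep.IsSemisimple ∧
        ∀ (v : HeightOneSpectrum (𝓞 K)) (α : Multiset ℂ), π.1.HasSatakeParamAt v α →
          ((ℓ : ℕ) : 𝓞 K) ∉ v.asIdeal →
            r.IsUnramifiedAt v ∧ r.HasFrobCharpolyAt v (arithFrobPolyOfSatake ι v.residueCard n α)) ↔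
    exists_galoisRep_of_regularAlgebraic :=
  ⟨fun h _ _ _ _ hcpt => h _ _ hcpt, fun h _ _ _ _ hcpt => h hcpt⟩

/-- **Closure of the item from the named fact**: the day
`Literature.NumberTheory.Automorphic.exists_galoisRep_of_regularAlgebraic_holds` lands, the item
closes by this one-liner (Harris–Lan–Taylor–Thorne 2016, Thm. A; Varma 2024, Cor. 9.3).
[cite: HarrisLanTaylorThorneRMS2016, Thm. A] -/
theorem of_fact (h : exists_galoisRep_of_regularAlgebraic) :
    ∀ (n : ℕ) (K : Type) [Field K] [NumberField K] (hcpt : isCompact_glFiniteIntegralLevel n K),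
      (IsTotallyReal K ∨ IsCMField K) → ∀ (π : CuspidalAutomorphicRepData n K hcpt),
      π.1.IsRegularAlgebraic → ∀ (ℓ : ℕ) [Fact ℓ.Prime] (ι : PadicAlgCl ℓ ≃+* ℂ),
      ∃ r : FramedGaloisRep K (PadicAlgCl ℓ) n, r.toGaloisRep.IsSemisimple ∧
        ∀ (v : HeightOneSpectrum (𝓞 K)) (α : Multiset ℂ), π.1.HasSatakeParamAt v α →
          ((ℓ : ℕ) : 𝓞 K) ∉ v.asIdeal →
            r.IsUnramifiedAt v ∧ r.HasFrobCharpolyAt v (arithFrobPolyOfSatake ι v.residueCard n α) :=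
  fun _ _ _ _ hcpt => h hcpt

/-! ### The item from the finest leaves isolated in the tree -/

/-- **The item from its leaves.**  Granted (1) Harris–Lan–Taylor–Thorne's Cor. 6.27 (rigid
cohomology of the ordinary locus; named fact `corollary627_splitOrUnramified`), (2) the archimedean
clause of Arthur–Clozel's strong lifting (`ArthurClozel1989_strongLifting_archimedean`), (3)
Arthur–Clozel's strong cuspidal base change in prime degree for extensions ramified at a place where
`π` is unramified (Ch. 3, Thm. 4.2 (a) with Thm. 5.1 and (1.1); Chenevier–Harris 2013, proof of
Prop. 3.1.1; hypothesis `hBC`, for which the tree has no named fact) and (4) Varma's Cor. 9.3 in its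
unramified-place form (`Varma2024.corollary93_unramified`), the item holds: (1)–(3) give the
existence half of Thm. A for every `n` (`theoremA_existence_of_leaves'`: Sorensen patching over the
family `K(√-D)`, Chebotarev, and Weil's rank-one case, all proved in the tree), and (4) upgrades
HLTT-compatibility to compatibility at every `v ∤ ℓ` (`exists_galoisRep_of_regularAlgebraic_of`).
This is the exact residue of the item in the tree's present state.
[cite: HarrisLanTaylorThorneRMS2016, Cor. 6.27, Thm. 7.13, Cor. 7.14 (p. 232)]
[cite: VarmaFMS2024, Cor. 9.3] -/
theorem of_leaves (h627 : corollary627_splitOrUnramified)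
    (harch : ArthurClozel1989_strongLifting_archimedean)
    (hBC : ∀ (n : ℕ) (F E : Type) [Field F] [NumberField F] [Field E] [NumberField E] [Algebra F E]
      [IsGalois F E], (Module.finrank F E).Prime →
      ∀ (hF : isCompact_glFiniteIntegralLevel n F) (π : CuspidalAutomorphicRepData n F hF),
        (∃ v : HeightOneSpectrum (𝓞 F),
            ¬ Algebra.IsUnramifiedIn (𝓞 E) v.asIdeal ∧ π.1.IsUnramifiedAt v) →
        ∀ (hE : isCompact_glFiniteIntegralLevel n E),
          ∃ P : CuspidalAutomorphicRepData n E hE,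
            ∀ (w : HeightOneSpectrum (𝓞 E)) (v : HeightOneSpectrum (𝓞 F)) (α : Multiset ℂ),
              w.asIdeal.under (𝓞 F) = v.asIdeal → Algebra.IsUnramifiedIn (𝓞 E) v.asIdeal →
                π.1.HasSatakeParamAt v α →
                  P.1.HasSatakeParamAt w (α.map (· ^ w.asIdeal.inertiaDeg (𝓞 F))))
    (hV : Varma2024.corollary93_unramified) :
    ∀ (n : ℕ) (K : Type) [Field K] [NumberField K] (hcpt : isCompact_glFiniteIntegralLevel n K),
      (IsTotallyReal K ∨ IsCMField K) → ∀ (π : CuspidalAutomorphicRepData n K hcpt),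
      π.1.IsRegularAlgebraic → ∀ (ℓ : ℕ) [Fact ℓ.Prime] (ι : PadicAlgCl ℓ ≃+* ℂ),
      ∃ r : FramedGaloisRep K (PadicAlgCl ℓ) n, r.toGaloisRep.IsSemisimple ∧
        ∀ (v : HeightOneSpectrum (𝓞 K)) (α : Multiset ℂ), π.1.HasSatakeParamAt v α →
          ((ℓ : ℕ) : 𝓞 K) ∉ v.asIdeal →
            r.IsUnramifiedAt v ∧ r.HasFrobCharpolyAt v (arithFrobPolyOfSatake ι v.residueCard n α) :=
  of_fact (exists_galoisRep_of_regularAlgebraic_of (theoremA_existence_of_leaves' h627 harch hBC) hV)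

/-! ### The slices `n = 0` and `n = 1`, unconditionally and for every number field -/

/-- **The item in rank `0`** (degenerate, every number field `K`, no algebraicity needed): the
trivial homomorphism `Γ_K → GL_0(ℚ̄_ℓ)` is semisimple (its space has one subrepresentation) and, a
Satake parameter on `GL_0` having no entries, the predicted polynomial is the empty product
`1 = det(X - ·)` on `0 × 0` matrices, while every inertia group maps to `1`. [folklore] -/
theorem rank_zero (K : Type) [Field K] [NumberField K] (hcpt : isCompact_glFiniteIntegralLevel 0 K)
    (π : CuspidalAutomorphicRepData 0 K hcpt) (ℓ : ℕ) [Fact ℓ.Prime] (ι : PadicAlgCl ℓ ≃+* ℂ) :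
    ∃ r : FramedGaloisRep K (PadicAlgCl ℓ) 0, r.toGaloisRep.IsSemisimple ∧
      ∀ (v : HeightOneSpectrum (𝓞 K)) (α : Multiset ℂ), π.1.HasSatakeParamAt v α →
        ((ℓ : ℕ) : 𝓞 K) ∉ v.asIdeal →
          r.IsUnramifiedAt v ∧ r.HasFrobCharpolyAt v (arithFrobPolyOfSatake ι v.residueCard 0 α) := by
  refine ⟨1, ?_, ?_⟩
  · haveI : Subsingleton (Subrepresentation
        ((1 : FramedGaloisRep K (PadicAlgCl ℓ) 0).toGaloisRep.toRepresentation)) :=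
      ⟨fun a b ↦ Subrepresentation.toSubmodule_injective (Subsingleton.elim _ _)⟩
    exact Subsingleton.instComplementedLattice
  · intro v α hα _
    have hα0 : α = 0 := Multiset.card_eq_zero.mp hα.card_eq
    subst hα0
    refine ⟨fun 𝔓 _ σ _ ↦ by simp, fun 𝔓 _ σ _ ↦ ?_⟩
    simp [FramedRep.charpoly, arithFrobPolyOfSatake, Matrix.charpoly, Matrix.det_isEmpty]

/-- **The item in rank `1`: Weil's theorem (1956), for every number field `K`.**  Let `π` be a
cuspidal regular algebraic automorphic representation of `GL₁(𝔸_K)` (Borel–Jacquet datum), `ℓ` a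
prime and `ι : ℚ̄_ℓ ≃+* ℂ`.  Then there is a continuous (semisimple, being of rank one)
`r : Γ_K → GL₁(ℚ̄_ℓ)` such that at every finite `v ∤ ℓ` where `π` has Satake parameter `α`, `r` is
unramified and the arithmetic Frobenius has characteristic polynomial
`arithFrobPolyOfSatake ι q_v 1 α = X - ι⁻¹(α⁻¹)`.  Proof: `π` has an algebraic Hecke character
`χ_π` (`exists_heckeCharacter_glOne`, `isAlgebraic_heckeCharacter_glOne_of_isCAlgebraic`); its
`ℓ`-adic avatar `r` (Weil 1956; `HeckeCharacter.IsAlgebraic.exists_lAdic`) is unramified at every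
`v ∤ ℓ` where `χ_π` is, with `char(Frob_v) = X - ι⁻¹(χ_π(ϖ_v))⁻¹`; where `π` is unramified so is
`χ_π` (`isUnramifiedAt_heckeCharacter_glOne`) and `α = {χ_π(ϖ_v)}`
(`exists_eq_singleton_of_hasSatakeParamAt_glOne`).  Same argument as the tree's
`theoremA_existence_rank_one` (HLTT shape), here with the item's stronger place clause.
[cite: Weil1956, §1–§2] [cite: HarrisLanTaylorThorneRMS2016, proof of Thm. 7.13 (p. 232, case n = 1)] -/
theorem rank_one (K : Type) [Field K] [NumberField K] (hcpt : isCompact_glFiniteIntegralLevel 1 K)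
    (π : CuspidalAutomorphicRepData 1 K hcpt) (hπ : π.1.IsRegularAlgebraic) (ℓ : ℕ) [Fact ℓ.Prime]
    (ι : PadicAlgCl ℓ ≃+* ℂ) :
    ∃ r : FramedGaloisRep K (PadicAlgCl ℓ) 1, r.toGaloisRep.IsSemisimple ∧
      ∀ (v : HeightOneSpectrum (𝓞 K)) (α : Multiset ℂ), π.1.HasSatakeParamAt v α →
        ((ℓ : ℕ) : 𝓞 K) ∉ v.asIdeal →
          r.IsUnramifiedAt v ∧ r.HasFrobCharpolyAt v (arithFrobPolyOfSatake ι v.residueCard 1 α) := by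
  classical
  obtain ⟨χ, hχ⟩ := π.1.exists_heckeCharacter_glOne
  have halg : χ.IsAlgebraic :=
    π.1.isAlgebraic_heckeCharacter_glOne_of_isCAlgebraic hχ hπ.isCAlgebraic
  obtain ⟨r, hr⟩ := halg.exists_lAdic ι
  refine ⟨r, FramedRep.isSemisimple_of_rank_one r, fun v α hα hvℓ => ?_⟩
  have hur : χ.IsUnramifiedAt v := π.1.isUnramifiedAt_heckeCharacter_glOne hχ hα
  obtain ⟨hunr, hfrob⟩ := hr v hvℓ hur
  refine ⟨hunr, ?_⟩
  obtain ⟨ϖ, hϖ, rfl⟩ := π.1.exists_eq_singleton_of_hasSatakeParamAt_glOne hχ hα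
  have hc : ((χ (localUnits v ϖ) : ℂˣ) : ℂ) = χ.valueAtUniformizer v := by
    rw [← HeckeCharacter.localComponent_eq_valueAtUniformizer hur hϖ,
      HeckeCharacter.localComponent_apply]
  rw [arithFrobPolyOfSatake_one, Multiset.map_singleton, Multiset.prod_singleton, hc]
  exact hfrob

/-- **The item holds in ranks `n ≤ 1`** — unconditionally, with the item's exact binder list (the
hypothesis "`K` totally real or CM" is not needed in these ranks): `rank_zero` and `rank_one`.
[cite: Weil1956, §1–§2] -/
theorem of_rank_le_one :
    ∀ (n : ℕ), n ≤ 1 → ∀ (K : Type) [Field K] [NumberField K]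
      (hcpt : isCompact_glFiniteIntegralLevel n K),
      (IsTotallyReal K ∨ IsCMField K) → ∀ (π : CuspidalAutomorphicRepData n K hcpt),
      π.1.IsRegularAlgebraic → ∀ (ℓ : ℕ) [Fact ℓ.Prime] (ι : PadicAlgCl ℓ ≃+* ℂ),
      ∃ r : FramedGaloisRep K (PadicAlgCl ℓ) n, r.toGaloisRep.IsSemisimple ∧
        ∀ (v : HeightOneSpectrum (𝓞 K)) (α : Multiset ℂ), π.1.HasSatakeParamAt v α →
          ((ℓ : ℕ) : 𝓞 K) ∉ v.asIdeal →
            r.IsUnramifiedAt v ∧ r.HasFrobCharpolyAt v (arithFrobPolyOfSatake ι v.residueCard n α) := by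
  intro n hn K _ _ hcpt _ π hπ ℓ _ ι
  rcases Nat.le_one_iff_eq_zero_or_eq_one.mp hn with rfl | rfl
  · exact rank_zero K hcpt π ℓ ι
  · exact rank_one K hcpt π hπ ℓ ι

/-! ### Without Varma: the almost-everywhere form from Thm. A (existence) alone -/

/-- **HLTT-compatibility is compatibility almost everywhere.**  If `r` has Harris–Lan–Taylor–Thorne's
property for `π` (`IsCompatible`: compatible at every place over a rational prime `q ≠ ℓ` above
which `π` is unramified), then `r` is compatible with `π` (`IsGaloisCompatibleAt`) at all but
finitely many places: the exceptions lie over `ℓ` or over a rational prime below one of the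
finitely many ramified places of `π` (Flath, `hasSatakeParamAt_cofinite_holds`; every place lies
over a unique rational prime, `exists_natPrime_natCast_mem`, `natPrime_eq_of_natCast_mem`; finitely
many places over a given prime, Mathlib `Ideal.finite_factors`).  The bookkeeping of the tree's
`theoremA_uniqueness_of`, isolated. [folklore] -/
theorem eventually_isGaloisCompatibleAt_of_isCompatible {n : ℕ} {K : Type} [Field K]
    [NumberField K] {hcpt : isCompact_glFiniteIntegralLevel n K} {ℓ : ℕ} [Fact ℓ.Prime]
    (π : AutomorphicRepData (AutomorphyDatum.gl n K hcpt)) (ι : PadicAlgCl ℓ ≃+* ℂ)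
    (r : FramedGaloisRep K (PadicAlgCl ℓ) n) (hc : IsCompatible π ι r) :
    ∀ᶠ v : HeightOneSpectrum (𝓞 K) in cofinite, IsGaloisCompatibleAt π ι r v := by
  -- bad places: those over `ℓ`, and those over a rational prime below a ramified place of `π`
  have hB : {w : HeightOneSpectrum (𝓞 K) | ¬ π.IsUnramifiedAt w}.Finite :=
    π.hasSatakeParamAt_cofinite_holds
  choose f hf using fun w : HeightOneSpectrum (𝓞 K) ↦ exists_natPrime_natCast_mem w
  have hfinite : ∀ {p : ℕ}, p ≠ 0 →
      {v : HeightOneSpectrum (𝓞 K) | ((p : ℕ) : 𝓞 K) ∈ v.asIdeal}.Finite := by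
    intro p hp
    have hne : Ideal.span {((p : ℕ) : 𝓞 K)} ≠ ⊥ := by
      rw [Ne, Ideal.span_singleton_eq_bot]
      exact_mod_cast hp
    convert Ideal.finite_factors hne using 2 with v
    simp [Ideal.dvd_span_singleton]
  have hSℓ : {v : HeightOneSpectrum (𝓞 K) | ((ℓ : ℕ) : 𝓞 K) ∈ v.asIdeal}.Finite :=
    hfinite (Fact.out : ℓ.Prime).ne_zero
  have hSB : (⋃ w ∈ {w : HeightOneSpectrum (𝓞 K) | ¬ π.IsUnramifiedAt w},
      {v : HeightOneSpectrum (𝓞 K) | ((f w : ℕ) : 𝓞 K) ∈ v.asIdeal}).Finite :=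
    hB.biUnion fun w _ ↦ hfinite (hf w).1.ne_zero
  rw [Filter.eventually_cofinite]
  refine (hSℓ.union hSB).subset fun v hv ↦ ?_
  by_contra hbad
  simp only [Set.mem_union, Set.mem_setOf_eq, Set.mem_iUnion, exists_prop, not_or, not_exists,
    not_and] at hbad
  obtain ⟨hvℓ, hvB⟩ := hbad
  apply hv
  -- `v` lies over the rational prime `q = f v ≠ ℓ`, above which `π` is unramified
  have hqℓ : f v ≠ ℓ := fun h ↦ hvℓ (h ▸ (hf v).2)
  refine hc (f v) (hf v).1 hqℓ (fun w hw ↦ ?_) v (hf v).2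
  by_contra hwr
  exact hvB w hwr ((natPrime_eq_of_natCast_mem (hf w).1 (hf v).1 (hf w).2 hw) ▸ (hf v).2)

/-- **The almost-everywhere form of the item from Thm. A (existence) alone** — no appeal to
Varma's theorem: for `K` totally real or CM, `π` regular algebraic cuspidal on `GL_n(𝔸_K)`, `ℓ`,
`ι`, there is a continuous semisimple `r : Γ_K → GL_n(ℚ̄_ℓ)` which, at all but finitely many finite
places `v`, is unramified with characteristic polynomial of Frobenius `arithFrobPolyOfSatake ι q_v n α`
for every Satake parameter `α` of `π` at `v` (`eventually_isGaloisCompatibleAt_of_isCompatible`).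
[cite: HarrisLanTaylorThorneRMS2016, Thm. A (p. 3)] -/
theorem ae_of_theoremA_existence (hA : theoremA_existence) :
    ∀ (n : ℕ) (K : Type) [Field K] [NumberField K] (hcpt : isCompact_glFiniteIntegralLevel n K),
      (IsTotallyReal K ∨ IsCMField K) → ∀ (π : CuspidalAutomorphicRepData n K hcpt),
      π.1.IsRegularAlgebraic → ∀ (ℓ : ℕ) [Fact ℓ.Prime] (ι : PadicAlgCl ℓ ≃+* ℂ),
      ∃ r : FramedGaloisRep K (PadicAlgCl ℓ) n, r.toGaloisRep.IsSemisimple ∧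
        ∀ᶠ v : HeightOneSpectrum (𝓞 K) in cofinite, ∀ α : Multiset ℂ, π.1.HasSatakeParamAt v α →
          r.IsUnramifiedAt v ∧ r.HasFrobCharpolyAt v (arithFrobPolyOfSatake ι v.residueCard n α) := by
  intro n K _ _ hcpt hK π hπ ℓ _ ι
  obtain ⟨r, hr, hc⟩ := hA hcpt hK π hπ ℓ ι
  exact ⟨r, hr, eventually_isGaloisCompatibleAt_of_isCompatible π.1 ι r hc⟩

/-- **The almost-everywhere form of the item from the three automorphic leaves of Thm. A** (HLTT
Cor. 6.27, Arthur–Clozel's archimedean clause, strong prime-degree cuspidal base change `hBC`) —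
Varma's theorem is not needed for it (`ae_of_theoremA_existence` ∘ `theoremA_existence_of_leaves'`).
[cite: HarrisLanTaylorThorneRMS2016, Thm. A (p. 3), Cor. 7.14 (p. 232)] -/
theorem ae_of_leaves (h627 : corollary627_splitOrUnramified)
    (harch : ArthurClozel1989_strongLifting_archimedean)
    (hBC : ∀ (n : ℕ) (F E : Type) [Field F] [NumberField F] [Field E] [NumberField E] [Algebra F E]
      [IsGalois F E], (Module.finrank F E).Prime →
      ∀ (hF : isCompact_glFiniteIntegralLevel n F) (π : CuspidalAutomorphicRepData n F hF),
        (∃ v : HeightOneSpectrum (𝓞 F),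
            ¬ Algebra.IsUnramifiedIn (𝓞 E) v.asIdeal ∧ π.1.IsUnramifiedAt v) →
        ∀ (hE : isCompact_glFiniteIntegralLevel n E),
          ∃ P : CuspidalAutomorphicRepData n E hE,
            ∀ (w : HeightOneSpectrum (𝓞 E)) (v : HeightOneSpectrum (𝓞 F)) (α : Multiset ℂ),
              w.asIdeal.under (𝓞 F) = v.asIdeal → Algebra.IsUnramifiedIn (𝓞 E) v.asIdeal →
                π.1.HasSatakeParamAt v α →
                  P.1.HasSatakeParamAt w (α.map (· ^ w.asIdeal.inertiaDeg (𝓞 F)))) :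
    ∀ (n : ℕ) (K : Type) [Field K] [NumberField K] (hcpt : isCompact_glFiniteIntegralLevel n K),
      (IsTotallyReal K ∨ IsCMField K) → ∀ (π : CuspidalAutomorphicRepData n K hcpt),
      π.1.IsRegularAlgebraic → ∀ (ℓ : ℕ) [Fact ℓ.Prime] (ι : PadicAlgCl ℓ ≃+* ℂ),
      ∃ r : FramedGaloisRep K (PadicAlgCl ℓ) n, r.toGaloisRep.IsSemisimple ∧
        ∀ᶠ v : HeightOneSpectrum (𝓞 K) in cofinite, ∀ α : Multiset ℂ, π.1.HasSatakeParamAt v α →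
          r.IsUnramifiedAt v ∧ r.HasFrobCharpolyAt v (arithFrobPolyOfSatake ι v.residueCard n α) :=
  ae_of_theoremA_existence (theoremA_existence_of_leaves' h627 harch hBC)

end Summit.Langlands.Langlands.Theorems.GaloisRepOfRegularAlgebraic

end
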